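import Literature.NumberTheory.Automorphic.SelfDualStableLatticeLevelBallCount     -- ★ A-p13 FILE 1: level-`i` ball counts `ncard_selfDualStable_smul_one_diag_level_self_eq_sum`, criterion, membership
import Literature.NumberTheory.Automorphic.SelfDualLatticeCountFrameTransport        -- ★ (L5-d1) FILE A: `image_map_inv_selfDualStable_eq`, `ncard_selfDualStable_congr`
import Literature.NumberTheory.Automorphic.UniformizerModularStableLatticeCount       -- ★ A-p03: `exists_mem_glInt_smul_coe_eq_formCongr_iff`, scalar frames `formCongr_eq_mul_self_smul_of_coe_eq_smul_one`
import HarnessLib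

/-!
# DEPTH COUNTS of the vertices fixed by an elliptic torus element in a hermitian plane: frame transport of the level predicate, the ϖ-modular
# (second vertex type) mirror, finiteness, and the EXACT-DEPTH counts `[i ≤ N ∧ N − i ≡ e (2)]·w(N − i)` (Flicker 1998 §6 p. 95; Kottwitz 1988 §2)

Topic `NumberTheory/Automorphic`; namespace `Literature.NumberTheory.Automorphic`.  THEOREMS ONLY (no definition, no instance, no notation, no named fact,
no `sorry`).  Cell `pub/hodgecm-mathlib`, F0∕P3a road «R1LL-tree» (LEAD F0P3a-plan (g10) WORD T9-8 (A); architect A-p16 (g27) RULINGS A-1 I-2 ∕ A-2 (a); design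
B-p12 (g29) census 86286e4d §3), hand A-p13 (g31); companion of ★ FILE 1 `SelfDualStableLatticeLevelBallCount`.  HC_CM is proved only modulo the printed citations
until rung 0 closes; nothing printed is a letter here — elementary lattice algebra over a discrete valuation ring.

THE LEVEL ∕ DEPTH PREDICATE (★ B-p08's token): `Λ.map (toLin' (↑γ − s • 1)) ≤ Λ.map (toLin' (c • 1))` («`γ ≡ s` on `Λ ⁄ cΛ`»; `c = ϖ^i`: depth `≥ i`).  In B-p12's matrix
currency (I-1 LEMMA U `localClass_normalForm`: `hki : ∀ r s, ϖ^{−i} (k − c•1) r s ∈ 𝒪` for `k = g⁻¹ γ g`) it reads §1 `map_sub_smul_one_le_iff_forall_mem`.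

* §1 TRANSPORT: `coe_inv_mul_sub_smul_one_mul` · `map_sub_smul_one_le_iff_forall_mem` (lattice token ↔ matrix token) · **`map_map_inv_le_iff`**
  (`(P⁻¹AP)(P⁻¹Λ) ≤ c(P⁻¹Λ) ↔ AΛ ≤ cΛ`, generic `n`) · `image_map_inv_selfDualStable_level_eq` · **`ncard_selfDualStable_level_congr`** (★ (L5-d1) with the level conjunct).
* §2 `map_pow_succ_smul_one_le` (`ϖ^{i+1}Λ ≤ ϖ^iΛ`), `map_le_map_pow_smul_one_of_succ`, `sum_filter_mod_two_add_le_eq` (ball = smaller ball + sphere).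
* §3 ϖ-MODULAR MIRROR: `setOf_modularStable_and_eq_selfDualStable_and` (★ A-p03's dictionary under any extra predicate) · `ncard_selfDualStable_level_smul_mul_self_eq`.
* §4 **`finite_selfDualStable_smul_one_diag`**; §5 **`ncard_modularStable_smul_one_diag_level_self_eq_sum`** (`Σ_{j ≤ N, j % 2 = 1 − e, j + i ≤ N} w(j)`, every `i`) ·
  **`ncard_selfDualStable_smul_one_diag_depth_eq_ite`** (`#{depth exactly i} = [i ≤ N ∧ (N − i) % 2 = e]·w(N − i)`).

## References
* [Flicker1998UnitaryFL] Y. Z. Flicker, *Elementary proof of the fundamental lemma for a unitary group*, Canad. J. Math. 50 (1998), §6 p. 95 + REMARK.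
* [Kottwitz1988] R. E. Kottwitz, *Tamagawa numbers*, Ann. of Math. 127 (1988), §2.
* [Macdonald1995] I. G. Macdonald, *Symmetric functions and Hall polynomials* (1995), Ch. V §2.
* [Serre1980Trees] J.-P. Serre, *Trees* (1980), Ch. II §1.1.
* [Jacobowitz1962] R. Jacobowitz, *Hermitian forms over local fields*, Amer. J. Math. 84 (1962), §7.
-/

set_option autoImplicit false

noncomputable section

open scoped ValuativeRel Matrix MatrixGroups
open Matrix ValuativeRel

namespace Literature.NumberTheory.Automorphic

variable {F : Type*} [Field F] [ValuativeRel F] (σ : F →+* F) {n : ℕ}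

/-! ## §1 The level predicate is equivariant under a change of frame -/

section Transport

omit [ValuativeRel F] in
/-- `P⁻¹ (γ − s·1) P = P⁻¹ γ P − s·1` (conjugation fixes scalars). [cite: Macdonald1995, Ch. V §2] -/
theorem coe_inv_mul_sub_smul_one_mul (P γ : GL (Fin n) F) (s : F) :
    ((P⁻¹ : GL (Fin n) F) : Matrix (Fin n) (Fin n) F) * ((γ : Matrix (Fin n) (Fin n) F) - s • (1 : Matrix (Fin n) (Fin n) F)) *
        (P : Matrix (Fin n) (Fin n) F) =
      ((P⁻¹ * γ * P : GL (Fin n) F) : Matrix (Fin n) (Fin n) F) - s • (1 : Matrix (Fin n) (Fin n) F) := by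
  rw [Matrix.mul_sub, Matrix.sub_mul, Matrix.mul_smul, Matrix.mul_one, Matrix.smul_mul, ← Units.val_mul P⁻¹ P, inv_mul_cancel, Units.val_one,
    Units.val_mul, Units.val_mul]

/-- **LATTICE TOKEN ↔ MATRIX TOKEN** (B-p12 (g29)'s I-1 currency `hki`): for `Λ = Λ(g)`, `(γ − s·1)Λ ≤ ϖ^i Λ ↔ ∀ r t, ϖ^{−i}·(g⁻¹γg − s·1) r t ∈ 𝒪` — ★ B-p08
`map_le_map_smul_one_iff` + `g⁻¹(γ − s·1)g = g⁻¹γg − s·1`. [cite: Macdonald1995, Ch. V §2] [cite: Kottwitz1988, §2] -/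
theorem map_sub_smul_one_le_iff_forall_mem {ϖ : F} (hϖ0 : ϖ ≠ 0) (γ g : GL (Fin n) F) (s : F) (i : ℕ) :
    (Submodule.span 𝒪[F] (Set.range ((g : Matrix (Fin n) (Fin n) F))ᵀ)).map
          ((Matrix.toLin' (((γ : GL (Fin n) F) : Matrix (Fin n) (Fin n) F) - s • (1 : Matrix (Fin n) (Fin n) F))).restrictScalars 𝒪[F]) ≤
        (Submodule.span 𝒪[F] (Set.range ((g : Matrix (Fin n) (Fin n) F))ᵀ)).map
          ((Matrix.toLin' (ϖ ^ i • (1 : Matrix (Fin n) (Fin n) F))).restrictScalars 𝒪[F]) ↔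
      ∀ r t, ϖ ^ (-(i : ℤ)) * (((g⁻¹ * γ * g : GL (Fin n) F) : Matrix (Fin n) (Fin n) F) - s • (1 : Matrix (Fin n) (Fin n) F)) r t ∈ 𝒪[F] := by
  rw [map_le_map_smul_one_iff g _ (pow_ne_zero i hϖ0), coe_inv_mul_sub_smul_one_mul,
    show (ϖ ^ i : F)⁻¹ = ϖ ^ (-(i : ℤ)) by rw [_root_.zpow_neg, zpow_natCast]]
  simp only [Matrix.smul_apply, smul_eq_mul]

/-- **EQUIVARIANCE OF THE LEVEL PREDICATE**: for any `𝒪`-submodule `Λ`, any matrix `A`, scalar `c` and `P ∈ GL_n(F)`,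
`(P⁻¹AP)·(P⁻¹Λ) ≤ c·(P⁻¹Λ) ↔ A·Λ ≤ c·Λ` (`P⁻¹` is an `𝒪`-linear automorphism commuting with scalars). [cite: Macdonald1995, Ch. V §2] [cite: Kottwitz1988, §2] -/
theorem map_map_inv_le_iff (P : GL (Fin n) F) (A : Matrix (Fin n) (Fin n) F) (c : F) (Λ : Submodule 𝒪[F] (Fin n → F)) :
    (Λ.map ((Matrix.toLin' ((P⁻¹ : GL (Fin n) F) : Matrix (Fin n) (Fin n) F)).restrictScalars 𝒪[F])).map
          ((Matrix.toLin' (((P⁻¹ : GL (Fin n) F) : Matrix (Fin n) (Fin n) F) * A * (P : Matrix (Fin n) (Fin n) F))).restrictScalars 𝒪[F]) ≤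
        (Λ.map ((Matrix.toLin' ((P⁻¹ : GL (Fin n) F) : Matrix (Fin n) (Fin n) F)).restrictScalars 𝒪[F])).map
          ((Matrix.toLin' (c • (1 : Matrix (Fin n) (Fin n) F))).restrictScalars 𝒪[F]) ↔
      Λ.map ((Matrix.toLin' A).restrictScalars 𝒪[F]) ≤ Λ.map ((Matrix.toLin' (c • (1 : Matrix (Fin n) (Fin n) F))).restrictScalars 𝒪[F]) := by
  have hinj : Function.Injective ((Matrix.toLin' ((P⁻¹ : GL (Fin n) F) : Matrix (Fin n) (Fin n) F)).restrictScalars 𝒪[F]) := fun v w hvw => by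
    have h := congrArg (fun x => (P : Matrix (Fin n) (Fin n) F) *ᵥ x) hvw
    simpa only [LinearMap.coe_restrictScalars, Matrix.toLin'_apply, Matrix.mulVec_mulVec, ← Units.val_mul, mul_inv_cancel,
      Units.val_one, Matrix.one_mulVec] using h
  have h1 : ((Matrix.toLin' (((P⁻¹ : GL (Fin n) F) : Matrix (Fin n) (Fin n) F) * A * (P : Matrix (Fin n) (Fin n) F))).restrictScalars 𝒪[F]).comp
        ((Matrix.toLin' ((P⁻¹ : GL (Fin n) F) : Matrix (Fin n) (Fin n) F)).restrictScalars 𝒪[F]) =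
      ((Matrix.toLin' ((P⁻¹ : GL (Fin n) F) : Matrix (Fin n) (Fin n) F)).restrictScalars 𝒪[F]).comp ((Matrix.toLin' A).restrictScalars 𝒪[F]) := by
    apply LinearMap.ext
    intro x
    simp only [LinearMap.comp_apply, LinearMap.restrictScalars_apply, Matrix.toLin'_apply, Matrix.mulVec_mulVec]
    rw [Matrix.mul_assoc (((P⁻¹ : GL (Fin n) F) : Matrix (Fin n) (Fin n) F) * A), ← Units.val_mul, mul_inv_cancel, Units.val_one, Matrix.mul_one]
  have h2 : ((Matrix.toLin' (c • (1 : Matrix (Fin n) (Fin n) F))).restrictScalars 𝒪[F]).comp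
        ((Matrix.toLin' ((P⁻¹ : GL (Fin n) F) : Matrix (Fin n) (Fin n) F)).restrictScalars 𝒪[F]) =
      ((Matrix.toLin' ((P⁻¹ : GL (Fin n) F) : Matrix (Fin n) (Fin n) F)).restrictScalars 𝒪[F]).comp
        ((Matrix.toLin' (c • (1 : Matrix (Fin n) (Fin n) F))).restrictScalars 𝒪[F]) := by
    apply LinearMap.ext
    intro x
    simp only [LinearMap.comp_apply, LinearMap.restrictScalars_apply, Matrix.toLin'_apply, Matrix.mulVec_mulVec, Matrix.smul_mul, Matrix.mul_smul,
      Matrix.one_mul, Matrix.mul_one]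
  rw [← Submodule.map_comp, ← Submodule.map_comp, h1, h2, Submodule.map_comp, Submodule.map_comp, Submodule.map_le_map_iff_of_injective hinj]

/-- **`P⁻¹ · {Λ ∈ S(J, γ) | (γ − s·1)Λ ≤ c·Λ} = {Λ ∈ S(ᵗσ(P) J P, P⁻¹γP) | (P⁻¹γP − s·1)Λ ≤ c·Λ}`** — ★ (L5-d1) `image_map_inv_selfDualStable_eq` with the LEVEL
conjunct carried by `map_map_inv_le_iff`. [cite: Kottwitz1988, §2] [cite: Macdonald1995, Ch. V §2] -/
theorem image_map_inv_selfDualStable_level_eq (J : Matrix (Fin n) (Fin n) F) (γ P : GL (Fin n) F) (s c : F) :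
    (fun Λ : Submodule 𝒪[F] (Fin n → F) => Λ.map ((Matrix.toLin' ((P⁻¹ : GL (Fin n) F) : Matrix (Fin n) (Fin n) F)).restrictScalars 𝒪[F])) ''
        {Λ : Submodule 𝒪[F] (Fin n → F) |
          ((∃ g : GL (Fin n) F, (∃ J' ∈ glInt n F, (J' : Matrix (Fin n) (Fin n) F) = formCongr σ g J) ∧
              Λ = Submodule.span 𝒪[F] (Set.range ((g : Matrix (Fin n) (Fin n) F))ᵀ)) ∧
            Λ.map ((Matrix.toLin' ((γ : GL (Fin n) F) : Matrix (Fin n) (Fin n) F)).restrictScalars 𝒪[F]) = Λ) ∧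
          Λ.map ((Matrix.toLin' (((γ : GL (Fin n) F) : Matrix (Fin n) (Fin n) F) - s • (1 : Matrix (Fin n) (Fin n) F))).restrictScalars 𝒪[F]) ≤
            Λ.map ((Matrix.toLin' (c • (1 : Matrix (Fin n) (Fin n) F))).restrictScalars 𝒪[F])} =
      {Λ : Submodule 𝒪[F] (Fin n → F) |
        ((∃ g : GL (Fin n) F, (∃ J' ∈ glInt n F, (J' : Matrix (Fin n) (Fin n) F) = formCongr σ g (formCongr σ P J)) ∧
            Λ = Submodule.span 𝒪[F] (Set.range ((g : Matrix (Fin n) (Fin n) F))ᵀ)) ∧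
          Λ.map ((Matrix.toLin' (((P⁻¹ * γ * P : GL (Fin n) F)) : Matrix (Fin n) (Fin n) F)).restrictScalars 𝒪[F]) = Λ) ∧
        Λ.map ((Matrix.toLin' (((P⁻¹ * γ * P : GL (Fin n) F) : Matrix (Fin n) (Fin n) F) - s • (1 : Matrix (Fin n) (Fin n) F))).restrictScalars 𝒪[F]) ≤
          Λ.map ((Matrix.toLin' (c • (1 : Matrix (Fin n) (Fin n) F))).restrictScalars 𝒪[F])} := by
  ext Λ'
  constructor
  · rintro ⟨Λ, ⟨hS, hlev⟩, rfl⟩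
    have hmem : Λ.map ((Matrix.toLin' ((P⁻¹ : GL (Fin n) F) : Matrix (Fin n) (Fin n) F)).restrictScalars 𝒪[F]) ∈
        (fun Λ : Submodule 𝒪[F] (Fin n → F) => Λ.map ((Matrix.toLin' ((P⁻¹ : GL (Fin n) F) : Matrix (Fin n) (Fin n) F)).restrictScalars 𝒪[F])) ''
          {Λ : Submodule 𝒪[F] (Fin n → F) |
            (∃ g : GL (Fin n) F, (∃ J' ∈ glInt n F, (J' : Matrix (Fin n) (Fin n) F) = formCongr σ g J) ∧
                Λ = Submodule.span 𝒪[F] (Set.range ((g : Matrix (Fin n) (Fin n) F))ᵀ)) ∧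
              Λ.map ((Matrix.toLin' ((γ : GL (Fin n) F) : Matrix (Fin n) (Fin n) F)).restrictScalars 𝒪[F]) = Λ} := ⟨Λ, hS, rfl⟩
    rw [image_map_inv_selfDualStable_eq σ J γ P] at hmem
    refine ⟨hmem, ?_⟩
    rw [← coe_inv_mul_sub_smul_one_mul, map_map_inv_le_iff]
    exact hlev
  · rintro ⟨hS', hlev'⟩
    have hmem : Λ' ∈ (fun Λ : Submodule 𝒪[F] (Fin n → F) => Λ.map ((Matrix.toLin' ((P⁻¹ : GL (Fin n) F) : Matrix (Fin n) (Fin n) F)).restrictScalars 𝒪[F])) ''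
          {Λ : Submodule 𝒪[F] (Fin n → F) |
            (∃ g : GL (Fin n) F, (∃ J' ∈ glInt n F, (J' : Matrix (Fin n) (Fin n) F) = formCongr σ g J) ∧
                Λ = Submodule.span 𝒪[F] (Set.range ((g : Matrix (Fin n) (Fin n) F))ᵀ)) ∧
              Λ.map ((Matrix.toLin' ((γ : GL (Fin n) F) : Matrix (Fin n) (Fin n) F)).restrictScalars 𝒪[F]) = Λ} := by
      rw [image_map_inv_selfDualStable_eq σ J γ P]; exact hS'
    obtain ⟨Λ, hS, rfl⟩ := hmem
    refine ⟨Λ, ⟨hS, ?_⟩, rfl⟩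
    rw [← coe_inv_mul_sub_smul_one_mul, map_map_inv_le_iff] at hlev'
    exact hlev'

/-- **FRAME TRANSPORT OF THE LEVEL COUNT: `#{Λ ∈ S(J, γ) | (γ − s·1)Λ ≤ c·Λ} = #{Λ ∈ S(ᵗσ(P)JP, P⁻¹γP) | (P⁻¹γP − s·1)Λ ≤ c·Λ}`** for every `P ∈ GL_n(F)` — the
★ (L5-d1) transport `ncard_selfDualStable_congr` with the level conjunct (`Λ ↦ P⁻¹Λ` is injective). [cite: Kottwitz1988, §2] [cite: Macdonald1995, Ch. V §2] -/
theorem ncard_selfDualStable_level_congr (J : Matrix (Fin n) (Fin n) F) (γ P : GL (Fin n) F) (s c : F) :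
    {Λ : Submodule 𝒪[F] (Fin n → F) |
        ((∃ g : GL (Fin n) F, (∃ J' ∈ glInt n F, (J' : Matrix (Fin n) (Fin n) F) = formCongr σ g J) ∧
            Λ = Submodule.span 𝒪[F] (Set.range ((g : Matrix (Fin n) (Fin n) F))ᵀ)) ∧
          Λ.map ((Matrix.toLin' ((γ : GL (Fin n) F) : Matrix (Fin n) (Fin n) F)).restrictScalars 𝒪[F]) = Λ) ∧
        Λ.map ((Matrix.toLin' (((γ : GL (Fin n) F) : Matrix (Fin n) (Fin n) F) - s • (1 : Matrix (Fin n) (Fin n) F))).restrictScalars 𝒪[F]) ≤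
          Λ.map ((Matrix.toLin' (c • (1 : Matrix (Fin n) (Fin n) F))).restrictScalars 𝒪[F])}.ncard =
      {Λ : Submodule 𝒪[F] (Fin n → F) |
        ((∃ g : GL (Fin n) F, (∃ J' ∈ glInt n F, (J' : Matrix (Fin n) (Fin n) F) = formCongr σ g (formCongr σ P J)) ∧
            Λ = Submodule.span 𝒪[F] (Set.range ((g : Matrix (Fin n) (Fin n) F))ᵀ)) ∧
          Λ.map ((Matrix.toLin' (((P⁻¹ * γ * P : GL (Fin n) F)) : Matrix (Fin n) (Fin n) F)).restrictScalars 𝒪[F]) = Λ) ∧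
        Λ.map ((Matrix.toLin' (((P⁻¹ * γ * P : GL (Fin n) F) : Matrix (Fin n) (Fin n) F) - s • (1 : Matrix (Fin n) (Fin n) F))).restrictScalars 𝒪[F]) ≤
          Λ.map ((Matrix.toLin' (c • (1 : Matrix (Fin n) (Fin n) F))).restrictScalars 𝒪[F])}.ncard := by
  rw [← image_map_inv_selfDualStable_level_eq σ J γ P s c, Set.ncard_image_of_injective]
  -- `Λ ↦ P⁻¹ Λ` is injective on submodules: compose with `Λ ↦ P Λ`
  intro Λ₁ Λ₂ h
  have key : ∀ Λ : Submodule 𝒪[F] (Fin n → F),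
      (Λ.map ((Matrix.toLin' ((P⁻¹ : GL (Fin n) F) : Matrix (Fin n) (Fin n) F)).restrictScalars 𝒪[F])).map
        ((Matrix.toLin' ((P : GL (Fin n) F) : Matrix (Fin n) (Fin n) F)).restrictScalars 𝒪[F]) = Λ := by
    intro Λ
    have hcomp : ((Matrix.toLin' ((P : GL (Fin n) F) : Matrix (Fin n) (Fin n) F)).restrictScalars 𝒪[F]).comp
        ((Matrix.toLin' ((P⁻¹ : GL (Fin n) F) : Matrix (Fin n) (Fin n) F)).restrictScalars 𝒪[F]) = LinearMap.id := by
      apply LinearMap.ext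
      intro x
      simp only [LinearMap.comp_apply, LinearMap.restrictScalars_apply, Matrix.toLin'_apply, LinearMap.id_apply, Matrix.mulVec_mulVec,
        ← Units.val_mul, mul_inv_cancel, Units.val_one, Matrix.one_mulVec]
    rw [← Submodule.map_comp, hcomp, Submodule.map_id]
  have h' := congrArg (fun Λ : Submodule 𝒪[F] (Fin n → F) =>
    Λ.map ((Matrix.toLin' ((P : GL (Fin n) F) : Matrix (Fin n) (Fin n) F)).restrictScalars 𝒪[F])) h
  simp only [key] at h'
  exact h'

end Transport

/-! ## §2 Monotonicity of the level predicate and the bookkeeping of the parity sums -/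

section Monotone

/-- **`ϖ^{i+1}·Λ ≤ ϖ^i·Λ`** for `ϖ ∈ 𝒪` (an `𝒪`-submodule is stable under `ϖ`). [cite: Macdonald1995, Ch. V §2] -/
theorem map_pow_succ_smul_one_le {ϖ : F} (hϖO : ϖ ∈ 𝒪[F]) (i : ℕ) (Λ : Submodule 𝒪[F] (Fin n → F)) :
    Λ.map ((Matrix.toLin' (ϖ ^ (i + 1) • (1 : Matrix (Fin n) (Fin n) F))).restrictScalars 𝒪[F]) ≤
      Λ.map ((Matrix.toLin' (ϖ ^ i • (1 : Matrix (Fin n) (Fin n) F))).restrictScalars 𝒪[F]) := by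
  rintro _ ⟨x, hx, rfl⟩
  refine ⟨(⟨ϖ, hϖO⟩ : 𝒪[F]) • x, Λ.smul_mem _ hx, ?_⟩
  simp only [LinearMap.restrictScalars_apply, Matrix.toLin'_apply, Matrix.smul_mulVec, Matrix.mulVec_smul, Matrix.one_mulVec, Subring.smul_def,
    smul_smul, pow_succ, mul_comm]

/-- **The level predicate is antitone in the level**: `(A)Λ ≤ ϖ^{i+1}Λ → (A)Λ ≤ ϖ^iΛ`. [cite: Macdonald1995, Ch. V §2] -/
theorem map_le_map_pow_smul_one_of_succ {ϖ : F} (hϖO : ϖ ∈ 𝒪[F]) (i : ℕ) (A : Matrix (Fin n) (Fin n) F) (Λ : Submodule 𝒪[F] (Fin n → F))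
    (h : Λ.map ((Matrix.toLin' A).restrictScalars 𝒪[F]) ≤ Λ.map ((Matrix.toLin' (ϖ ^ (i + 1) • (1 : Matrix (Fin n) (Fin n) F))).restrictScalars 𝒪[F])) :
    Λ.map ((Matrix.toLin' A).restrictScalars 𝒪[F]) ≤ Λ.map ((Matrix.toLin' (ϖ ^ i • (1 : Matrix (Fin n) (Fin n) F))).restrictScalars 𝒪[F]) :=
  h.trans (map_pow_succ_smul_one_le hϖO i Λ)

omit [ValuativeRel F] in
/-- **BOOKKEEPING OF THE PARITY SUMS**: `Σ_{j ≤ N, j ≡ e, j + i ≤ N} f(j) = Σ_{j ≤ N, j ≡ e, j + (i+1) ≤ N} f(j) + [i ≤ N ∧ N − i ≡ e]·f(N − i)` — the ball of radius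
`N − i` is the ball of radius `N − i − 1` plus the sphere `j = N − i` (present iff its parity is `e`). [cite: Serre1980Trees, Ch. II §1.1] -/
theorem sum_filter_mod_two_add_le_eq (f : ℕ → ℕ) (N e i : ℕ) :
    ∑ j ∈ (Finset.range (N + 1)).filter (fun j => j % 2 = e ∧ j + i ≤ N), f j =
      (∑ j ∈ (Finset.range (N + 1)).filter (fun j => j % 2 = e ∧ j + (i + 1) ≤ N), f j) +
        (if i ≤ N ∧ (N - i) % 2 = e then f (N - i) else 0) := by
  rw [← Finset.sum_filter_add_sum_filter_not ((Finset.range (N + 1)).filter (fun j => j % 2 = e ∧ j + i ≤ N)) (fun j => j + (i + 1) ≤ N) f,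
    Finset.filter_filter, Finset.filter_filter]
  congr 1
  · refine Finset.sum_congr (Finset.filter_congr fun j _ => ?_) fun _ _ => rfl
    exact ⟨fun h => ⟨h.1.1, h.2⟩, fun h => ⟨⟨h.1, by omega⟩, h.2⟩⟩
  · split_ifs with hi
    · rw [Finset.sum_eq_single_of_mem (N - i) (by simp only [Finset.mem_filter, Finset.mem_range]; omega)
        (fun j hj hne => absurd hj (by simp only [Finset.mem_filter, Finset.mem_range]; omega))]
    · exact Finset.sum_eq_zero fun j hj => absurd hj (by simp only [Finset.mem_filter, Finset.mem_range]; omega)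

end Monotone

/-! ## §3 The ϖ-modular (type-`1 − e`) vertices: the same sets for the form `ϖ⁻¹ • H`, and scalar frames -/

section Modular

/-- **`{Λ ∈ M(H, γ) | X Λ} = {Λ ∈ S(c⁻¹ • H, γ) | X Λ}`** for any further condition `X` — ★ A-p03 `exists_mem_glInt_smul_coe_eq_formCongr_iff` pointwise (`c = ϖ`:
the ϖ-modular vertices with a level condition are the `ϖ⁻¹H`-self-dual ones with the same condition). [cite: Jacobowitz1962, §7] [cite: Kottwitz1988, §2] -/
theorem setOf_modularStable_and_eq_selfDualStable_and {c : F} (hc : c ≠ 0) (H : Matrix (Fin 2) (Fin 2) F) (γ : GL (Fin 2) F)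
    (X : Submodule 𝒪[F] (Fin 2 → F) → Prop) :
    {Λ : Submodule 𝒪[F] (Fin 2 → F) |
        ((∃ g : GL (Fin 2) F, (∃ J' ∈ glInt 2 F, c • (J' : Matrix (Fin 2) (Fin 2) F) = formCongr σ g H) ∧
            Λ = Submodule.span 𝒪[F] (Set.range ((g : Matrix (Fin 2) (Fin 2) F))ᵀ)) ∧
          Λ.map ((Matrix.toLin' (γ : Matrix (Fin 2) (Fin 2) F)).restrictScalars 𝒪[F]) = Λ) ∧ X Λ} =
      {Λ : Submodule 𝒪[F] (Fin 2 → F) |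
        ((∃ g : GL (Fin 2) F, (∃ J' ∈ glInt 2 F, (J' : Matrix (Fin 2) (Fin 2) F) = formCongr σ g (c⁻¹ • H)) ∧
            Λ = Submodule.span 𝒪[F] (Set.range ((g : Matrix (Fin 2) (Fin 2) F))ᵀ)) ∧
          Λ.map ((Matrix.toLin' (γ : Matrix (Fin 2) (Fin 2) F)).restrictScalars 𝒪[F]) = Λ) ∧ X Λ} := by
  ext Λ
  simp only [Set.mem_setOf_eq, exists_mem_glInt_smul_coe_eq_formCongr_iff σ hc]

/-- **EXPONENTS COUNT MOD 2, WITH A LEVEL CONDITION**: `#{Λ ∈ S((c·c) • H, γ) | (γ − s·1)Λ ≤ d·Λ} = #{Λ ∈ S(H, γ) | (γ − s·1)Λ ≤ d·Λ}` for `σ`-fixed `c ≠ 0` —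
§1 `ncard_selfDualStable_level_congr` at the scalar frame `P = c • 1` (★ A-p03 `formCongr_eq_mul_self_smul_of_coe_eq_smul_one`, `inv_mul_mul_eq_self_of_coe_eq_smul_one`).
[cite: Kottwitz1988, §2] [cite: Flicker1998UnitaryFL, §6 p. 95 REMARK] -/
theorem ncard_selfDualStable_level_smul_mul_self_eq {c : F} (hc : c ≠ 0) (hσc : σ c = c) (H : Matrix (Fin 2) (Fin 2) F) (γ : GL (Fin 2) F) (s d : F) :
    {Λ : Submodule 𝒪[F] (Fin 2 → F) |
        ((∃ g : GL (Fin 2) F, (∃ J' ∈ glInt 2 F, (J' : Matrix (Fin 2) (Fin 2) F) = formCongr σ g ((c * c) • H)) ∧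
            Λ = Submodule.span 𝒪[F] (Set.range ((g : Matrix (Fin 2) (Fin 2) F))ᵀ)) ∧
          Λ.map ((Matrix.toLin' ((γ : GL (Fin 2) F) : Matrix (Fin 2) (Fin 2) F)).restrictScalars 𝒪[F]) = Λ) ∧
        Λ.map ((Matrix.toLin' (((γ : GL (Fin 2) F) : Matrix (Fin 2) (Fin 2) F) - s • (1 : Matrix (Fin 2) (Fin 2) F))).restrictScalars 𝒪[F]) ≤
          Λ.map ((Matrix.toLin' (d • (1 : Matrix (Fin 2) (Fin 2) F))).restrictScalars 𝒪[F])}.ncard =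
      {Λ : Submodule 𝒪[F] (Fin 2 → F) |
        ((∃ g : GL (Fin 2) F, (∃ J' ∈ glInt 2 F, (J' : Matrix (Fin 2) (Fin 2) F) = formCongr σ g H) ∧
            Λ = Submodule.span 𝒪[F] (Set.range ((g : Matrix (Fin 2) (Fin 2) F))ᵀ)) ∧
          Λ.map ((Matrix.toLin' ((γ : GL (Fin 2) F) : Matrix (Fin 2) (Fin 2) F)).restrictScalars 𝒪[F]) = Λ) ∧
        Λ.map ((Matrix.toLin' (((γ : GL (Fin 2) F) : Matrix (Fin 2) (Fin 2) F) - s • (1 : Matrix (Fin 2) (Fin 2) F))).restrictScalars 𝒪[F]) ≤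
          Λ.map ((Matrix.toLin' (d • (1 : Matrix (Fin 2) (Fin 2) F))).restrictScalars 𝒪[F])}.ncard := by
  set P : GL (Fin 2) F := ⟨c • (1 : Matrix (Fin 2) (Fin 2) F), c⁻¹ • (1 : Matrix (Fin 2) (Fin 2) F),
    by rw [Matrix.smul_mul, Matrix.one_mul, smul_smul, mul_inv_cancel₀ hc, one_smul],
    by rw [Matrix.smul_mul, Matrix.one_mul, smul_smul, inv_mul_cancel₀ hc, one_smul]⟩ with hPdef
  have hP : (P : Matrix (Fin 2) (Fin 2) F) = c • (1 : Matrix (Fin 2) (Fin 2) F) := rfl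
  have h := ncard_selfDualStable_level_congr σ H γ P s d
  rw [formCongr_eq_mul_self_smul_of_coe_eq_smul_one σ hσc P hP, inv_mul_mul_eq_self_of_coe_eq_smul_one P hP] at h
  exact h.symm

end Modular

/-! ## §4 Finiteness of the set of `γ`-stable self-dual lattices (normalised frame) -/

section Finite

variable {ϖ : F} (hϖ : IsUniformizingElement ϖ)
variable (σO : 𝒪[F] →+* 𝒪[F]) (hσO' : ∀ x : 𝒪[F], ((σO x : 𝒪[F]) : F) = σ x) (hσσ : ∀ x, σO (σO x) = x)
  (hσϖ : σ ϖ = ϖ) {e : ℕ} (he : e ≤ 1)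
  {a c : F} {N : ℕ} (γ : GL (Fin 2) F) (hγ : (γ : Matrix (Fin 2) (Fin 2) F) = !![a, 0; 0, c])
  (ha : valuation F a = 1) (hc : valuation F c = 1) (hN : valuation F (a - c) = valuation F (ϖ ^ N))

include hϖ hσO' hσσ hσϖ he hγ ha hc hN in
/-- **`S(ϖ^e • 1, γ)` IS FINITE** (normalised frame of ★ (L5-d3)): its `ncard` is `Σ_{j ≤ N, j ≡ e} w(j) > 0` unless `e = 1, N = 0`, and then the set is empty
(a member is a self-dual Hermite lattice with `0 ≤ 2k + 1 ≤ N = 0`); so exact-depth counts are differences. [cite: Flicker1998UnitaryFL, §6 p. 95] [cite: Kottwitz1988, §2] -/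
theorem finite_selfDualStable_smul_one_diag [IsDiscreteValuationRing 𝒪[F]] [Finite (IsLocalRing.ResidueField 𝒪[F])]
    [IsAdicComplete (IsLocalRing.maximalIdeal 𝒪[F]) 𝒪[F]] {a₀ : 𝒪[F]} (ha₀ : IsUnit (σO a₀ - a₀)) {q : ℕ}
    (hq : Nat.card (IsLocalRing.ResidueField 𝒪[F]) = q ^ 2) :
    {Λ : Submodule 𝒪[F] (Fin 2 → F) |
        (∃ g : GL (Fin 2) F, (∃ J' ∈ glInt 2 F, (J' : Matrix (Fin 2) (Fin 2) F) = formCongr σ g ((ϖ ^ (e : ℤ)) • (1 : Matrix (Fin 2) (Fin 2) F))) ∧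
          Λ = Submodule.span 𝒪[F] (Set.range ((g : Matrix (Fin 2) (Fin 2) F))ᵀ)) ∧
        Λ.map ((Matrix.toLin' (γ : Matrix (Fin 2) (Fin 2) F)).restrictScalars 𝒪[F]) = Λ}.Finite := by
  have hσO : ∀ x ∈ 𝒪[F], σ x ∈ 𝒪[F] := fun x hx => by rw [← hσO' ⟨x, hx⟩]; exact (σO ⟨x, hx⟩).2
  by_cases hNe : e ≤ N
  · refine Set.finite_of_ncard_ne_zero ?_
    rw [ncard_selfDualStable_smul_one_diag_eq_sum hϖ σO hσO' hσσ hσϖ he γ hγ ha hc hN ha₀ hq]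
    refine Nat.pos_iff_ne_zero.1 (Finset.sum_pos' (fun _ _ => Nat.zero_le _) ⟨e, ?_, ?_⟩)
    · simp only [Finset.mem_filter, Finset.mem_range]
      constructor <;> omega
    · split_ifs
      · exact Nat.one_pos
      · have hq0 : 0 < q := by
          rcases Nat.eq_zero_or_pos q with rfl | h
          · rw [zero_pow two_ne_zero] at hq
            exact absurd hq (Nat.card_pos (α := IsLocalRing.ResidueField 𝒪[F])).ne'
          · exact h
        exact Nat.mul_pos (pow_pos hq0 _) (Nat.succ_pos q)
  · -- `e = 1`, `N = 0`: the set is empty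
    have hempty : {Λ : Submodule 𝒪[F] (Fin 2 → F) |
        (∃ g : GL (Fin 2) F, (∃ J' ∈ glInt 2 F, (J' : Matrix (Fin 2) (Fin 2) F) = formCongr σ g ((ϖ ^ (e : ℤ)) • (1 : Matrix (Fin 2) (Fin 2) F))) ∧
          Λ = Submodule.span 𝒪[F] (Set.range ((g : Matrix (Fin 2) (Fin 2) F))ᵀ)) ∧
        Λ.map ((Matrix.toLin' (γ : Matrix (Fin 2) (Fin 2) F)).restrictScalars 𝒪[F]) = Λ} = ∅ := by
      refine Set.subset_empty_iff.1 fun Λ hΛ => ?_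
      obtain ⟨k, y, g, hg, hsd, -, hle⟩ := (mem_selfDualStable_smul_one_diag_iff hϖ hσϖ hσO γ hγ ha hc hN Λ).1 hΛ
      obtain ⟨-, hj, -, -⟩ := (exists_mem_glInt_coe_eq_formCongr_hermite_iff hϖ σ hσϖ hσO g hg).1 hsd
      exact hNe (by omega)
    exact hempty ▸ Set.finite_empty

end Finite

/-! ## §5 The ϖ-modular level counts and the EXACT-DEPTH counts (both vertex types), normalised frame -/

section Depth

variable {ϖ : F} (hϖ : IsUniformizingElement ϖ)
variable (σO : 𝒪[F] →+* 𝒪[F]) (hσO' : ∀ x : 𝒪[F], ((σO x : 𝒪[F]) : F) = σ x) (hσσ : ∀ x, σO (σO x) = x)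
  (hσϖ : σ ϖ = ϖ) {e : ℕ} (he : e ≤ 1)
  {a c : F} {N : ℕ} (γ : GL (Fin 2) F) (hγ : (γ : Matrix (Fin 2) (Fin 2) F) = !![a, 0; 0, c])
  (ha : valuation F a = 1) (hc : valuation F c = 1) (hN : valuation F (a - c) = valuation F (ϖ ^ N))

include hϖ hσO' hσσ hσϖ he hγ ha hc hN in
/-- **THE ϖ-MODULAR LEVEL-`i` COUNT** (type `1 − e` vertices of the fixed ball at depth `≥ i`): for `e ∈ {0,1}`, `↑γ = diag(a, c)`, `|a| = |c| = 1`, `|a − c| = |ϖ^N|`,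
`#{Λ ∈ M(ϖ^e • 1, γ) | (γ − c·1)Λ ≤ ϖ^iΛ} = Σ_{j ≤ N, j % 2 = 1 − e, j + i ≤ N} w(j)` for EVERY `i` — §3 dictionary, the scalar frame `ϖ⁻¹•1` (`e = 0`), ★ FILE 1 at the
other parity (pattern ★ A-p03 `ncard_modularStable_smul_one_diag_eq_sum`). [cite: Kottwitz1988, §2] [cite: Flicker1998UnitaryFL, §6 p. 95 REMARK] -/
theorem ncard_modularStable_smul_one_diag_level_self_eq_sum [IsDiscreteValuationRing 𝒪[F]] [Finite (IsLocalRing.ResidueField 𝒪[F])]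
    [IsAdicComplete (IsLocalRing.maximalIdeal 𝒪[F]) 𝒪[F]] {a₀ : 𝒪[F]} (ha₀ : IsUnit (σO a₀ - a₀)) {q : ℕ}
    (hq : Nat.card (IsLocalRing.ResidueField 𝒪[F]) = q ^ 2) (i : ℕ) :
    {Λ : Submodule 𝒪[F] (Fin 2 → F) |
        ((∃ g : GL (Fin 2) F, (∃ J' ∈ glInt 2 F, ϖ • (J' : Matrix (Fin 2) (Fin 2) F) = formCongr σ g ((ϖ ^ (e : ℤ)) • (1 : Matrix (Fin 2) (Fin 2) F))) ∧
            Λ = Submodule.span 𝒪[F] (Set.range ((g : Matrix (Fin 2) (Fin 2) F))ᵀ)) ∧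
          Λ.map ((Matrix.toLin' (γ : Matrix (Fin 2) (Fin 2) F)).restrictScalars 𝒪[F]) = Λ) ∧
        Λ.map ((Matrix.toLin' ((γ : Matrix (Fin 2) (Fin 2) F) - c • (1 : Matrix (Fin 2) (Fin 2) F))).restrictScalars 𝒪[F]) ≤
          Λ.map ((Matrix.toLin' (ϖ ^ i • (1 : Matrix (Fin 2) (Fin 2) F))).restrictScalars 𝒪[F])}.ncard =
      ∑ j ∈ (Finset.range (N + 1)).filter (fun j => j % 2 = 1 - e ∧ j + i ≤ N), (if j = 0 then 1 else q ^ (j - 1) * (q + 1)) := by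
  have hϖ0 : ϖ ≠ 0 := hϖ.ne_zero
  rw [setOf_modularStable_and_eq_selfDualStable_and σ hϖ0 _ γ (fun Λ =>
    Λ.map ((Matrix.toLin' ((γ : Matrix (Fin 2) (Fin 2) F) - c • (1 : Matrix (Fin 2) (Fin 2) F))).restrictScalars 𝒪[F]) ≤
      Λ.map ((Matrix.toLin' (ϖ ^ i • (1 : Matrix (Fin 2) (Fin 2) F))).restrictScalars 𝒪[F]))]
  rcases Nat.le_one_iff_eq_zero_or_eq_one.1 he with rfl | rfl
  · -- `e = 0`: `ϖ⁻¹ • (ϖ^0 • 1) = (ϖ⁻¹·ϖ⁻¹) • (ϖ^1 • 1)`, scalar frame, ★ level count at parity `1`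
    have hform : ϖ⁻¹ • ((ϖ ^ ((0 : ℕ) : ℤ)) • (1 : Matrix (Fin 2) (Fin 2) F)) = (ϖ⁻¹ * ϖ⁻¹) • ((ϖ ^ ((1 : ℕ) : ℤ)) • (1 : Matrix (Fin 2) (Fin 2) F)) := by
      rw [smul_smul, smul_smul, Nat.cast_zero, zpow_zero, mul_one, Nat.cast_one, zpow_one, mul_assoc, inv_mul_cancel₀ hϖ0, mul_one]
    rw [hform, ncard_selfDualStable_level_smul_mul_self_eq σ (inv_ne_zero hϖ0) (by rw [map_inv₀, hσϖ])]
    exact ncard_selfDualStable_smul_one_diag_level_self_eq_sum hϖ σO hσO' hσσ hσϖ le_rfl γ hγ ha hc hN ha₀ hq i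
  · -- `e = 1`: `ϖ⁻¹ • (ϖ^1 • 1) = ϖ^0 • 1`, ★ level count at parity `0`
    have hform : ϖ⁻¹ • ((ϖ ^ ((1 : ℕ) : ℤ)) • (1 : Matrix (Fin 2) (Fin 2) F)) = (ϖ ^ ((0 : ℕ) : ℤ)) • (1 : Matrix (Fin 2) (Fin 2) F) := by
      rw [smul_smul, Nat.cast_one, zpow_one, inv_mul_cancel₀ hϖ0, Nat.cast_zero, zpow_zero]
    rw [hform]
    exact ncard_selfDualStable_smul_one_diag_level_self_eq_sum hϖ σO hσO' hσσ hσϖ (Nat.zero_le 1) γ hγ ha hc hN ha₀ hq i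

include hϖ hσO' hσσ hσϖ he hγ ha hc hN in
/-- **EXACT DEPTH, SELF-DUAL (type-`e`) vertices**: `#{Λ ∈ S(ϖ^e • 1, γ) | (γ − c·1)Λ ≤ ϖ^iΛ ∧ ¬ (γ − c·1)Λ ≤ ϖ^{i+1}Λ} = [i ≤ N ∧ N − i ≡ e (2)]·w(N − i)` (the type-`e`
vertices at distance EXACTLY `N − i` from the fixed vertex; §4 + `Set.ncard_sdiff_add_ncard_of_subset` + §2) — the `[N−i ≡ e+ε]·w(N−i)` coefficient of B-p12 (g29)'s
unfolding display (`ε = 0`). [cite: Kottwitz1988, §2] [cite: Flicker1998UnitaryFL, §6 p. 95 REMARK] -/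
theorem ncard_selfDualStable_smul_one_diag_depth_eq_ite [IsDiscreteValuationRing 𝒪[F]] [Finite (IsLocalRing.ResidueField 𝒪[F])]
    [IsAdicComplete (IsLocalRing.maximalIdeal 𝒪[F]) 𝒪[F]] {a₀ : 𝒪[F]} (ha₀ : IsUnit (σO a₀ - a₀)) {q : ℕ}
    (hq : Nat.card (IsLocalRing.ResidueField 𝒪[F]) = q ^ 2) (i : ℕ) :
    {Λ : Submodule 𝒪[F] (Fin 2 → F) |
        ((∃ g : GL (Fin 2) F, (∃ J' ∈ glInt 2 F, (J' : Matrix (Fin 2) (Fin 2) F) = formCongr σ g ((ϖ ^ (e : ℤ)) • (1 : Matrix (Fin 2) (Fin 2) F))) ∧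
            Λ = Submodule.span 𝒪[F] (Set.range ((g : Matrix (Fin 2) (Fin 2) F))ᵀ)) ∧
          Λ.map ((Matrix.toLin' (γ : Matrix (Fin 2) (Fin 2) F)).restrictScalars 𝒪[F]) = Λ) ∧
        (Λ.map ((Matrix.toLin' ((γ : Matrix (Fin 2) (Fin 2) F) - c • (1 : Matrix (Fin 2) (Fin 2) F))).restrictScalars 𝒪[F]) ≤
          Λ.map ((Matrix.toLin' (ϖ ^ i • (1 : Matrix (Fin 2) (Fin 2) F))).restrictScalars 𝒪[F]) ∧
        ¬ Λ.map ((Matrix.toLin' ((γ : Matrix (Fin 2) (Fin 2) F) - c • (1 : Matrix (Fin 2) (Fin 2) F))).restrictScalars 𝒪[F]) ≤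
          Λ.map ((Matrix.toLin' (ϖ ^ (i + 1) • (1 : Matrix (Fin 2) (Fin 2) F))).restrictScalars 𝒪[F]))}.ncard =
      if i ≤ N ∧ (N - i) % 2 = e then (if N - i = 0 then 1 else q ^ (N - i - 1) * (q + 1)) else 0 := by
  have hfin := finite_selfDualStable_smul_one_diag σ hϖ σO hσO' hσσ hσϖ he γ hγ ha hc hN ha₀ hq
  have hi := ncard_selfDualStable_smul_one_diag_level_self_eq_sum hϖ σO hσO' hσσ hσϖ he γ hγ ha hc hN ha₀ hq i
  have hi1 := ncard_selfDualStable_smul_one_diag_level_self_eq_sum hϖ σO hσO' hσσ hσϖ he γ hγ ha hc hN ha₀ hq (i + 1)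
  rw [sum_filter_mod_two_add_le_eq _ N e i] at hi
  -- the two consecutive level sets `S_i ⊇ S_{i+1}`; the exact-depth set is `S_i ∖ S_{i+1}`
  set Si := {Λ : Submodule 𝒪[F] (Fin 2 → F) |
        ((∃ g : GL (Fin 2) F, (∃ J' ∈ glInt 2 F, (J' : Matrix (Fin 2) (Fin 2) F) = formCongr σ g ((ϖ ^ (e : ℤ)) • (1 : Matrix (Fin 2) (Fin 2) F))) ∧
            Λ = Submodule.span 𝒪[F] (Set.range ((g : Matrix (Fin 2) (Fin 2) F))ᵀ)) ∧
          Λ.map ((Matrix.toLin' (γ : Matrix (Fin 2) (Fin 2) F)).restrictScalars 𝒪[F]) = Λ) ∧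
        Λ.map ((Matrix.toLin' ((γ : Matrix (Fin 2) (Fin 2) F) - c • (1 : Matrix (Fin 2) (Fin 2) F))).restrictScalars 𝒪[F]) ≤
          Λ.map ((Matrix.toLin' (ϖ ^ i • (1 : Matrix (Fin 2) (Fin 2) F))).restrictScalars 𝒪[F])} with hSi
  set Si1 := {Λ : Submodule 𝒪[F] (Fin 2 → F) |
        ((∃ g : GL (Fin 2) F, (∃ J' ∈ glInt 2 F, (J' : Matrix (Fin 2) (Fin 2) F) = formCongr σ g ((ϖ ^ (e : ℤ)) • (1 : Matrix (Fin 2) (Fin 2) F))) ∧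
            Λ = Submodule.span 𝒪[F] (Set.range ((g : Matrix (Fin 2) (Fin 2) F))ᵀ)) ∧
          Λ.map ((Matrix.toLin' (γ : Matrix (Fin 2) (Fin 2) F)).restrictScalars 𝒪[F]) = Λ) ∧
        Λ.map ((Matrix.toLin' ((γ : Matrix (Fin 2) (Fin 2) F) - c • (1 : Matrix (Fin 2) (Fin 2) F))).restrictScalars 𝒪[F]) ≤
          Λ.map ((Matrix.toLin' (ϖ ^ (i + 1) • (1 : Matrix (Fin 2) (Fin 2) F))).restrictScalars 𝒪[F])} with hSi1
  have hsub : Si1 ⊆ Si := fun Λ hΛ => ⟨hΛ.1, map_le_map_pow_smul_one_of_succ hϖ.mem i _ Λ hΛ.2⟩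
  have hsplit := Set.ncard_sdiff_add_ncard_of_subset hsub (hfin.subset fun Λ hΛ => hΛ.1)
  rw [hi, hi1] at hsplit
  have hdiff : {Λ : Submodule 𝒪[F] (Fin 2 → F) |
        ((∃ g : GL (Fin 2) F, (∃ J' ∈ glInt 2 F, (J' : Matrix (Fin 2) (Fin 2) F) = formCongr σ g ((ϖ ^ (e : ℤ)) • (1 : Matrix (Fin 2) (Fin 2) F))) ∧
            Λ = Submodule.span 𝒪[F] (Set.range ((g : Matrix (Fin 2) (Fin 2) F))ᵀ)) ∧
          Λ.map ((Matrix.toLin' (γ : Matrix (Fin 2) (Fin 2) F)).restrictScalars 𝒪[F]) = Λ) ∧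
        (Λ.map ((Matrix.toLin' ((γ : Matrix (Fin 2) (Fin 2) F) - c • (1 : Matrix (Fin 2) (Fin 2) F))).restrictScalars 𝒪[F]) ≤
          Λ.map ((Matrix.toLin' (ϖ ^ i • (1 : Matrix (Fin 2) (Fin 2) F))).restrictScalars 𝒪[F]) ∧
        ¬ Λ.map ((Matrix.toLin' ((γ : Matrix (Fin 2) (Fin 2) F) - c • (1 : Matrix (Fin 2) (Fin 2) F))).restrictScalars 𝒪[F]) ≤
          Λ.map ((Matrix.toLin' (ϖ ^ (i + 1) • (1 : Matrix (Fin 2) (Fin 2) F))).restrictScalars 𝒪[F]))} = Si \ Si1 := by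
    ext Λ
    simp only [hSi, hSi1, Set.mem_setOf_eq, Set.mem_sdiff, not_and]
    exact ⟨fun h => ⟨⟨h.1, h.2.1⟩, fun _ => h.2.2⟩, fun h => ⟨h.1.1, h.1.2, h.2 h.1.1⟩⟩
  rw [hdiff]
  omega

end Depth

end Literature.NumberTheory.Automorphic

end
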